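import Literature.Geometry.Lorentzian.IPlusRegular
import Mathlib.Geometry.Manifold.IntegralCurve.Basic
import Mathlib.Geometry.Manifold.MFDeriv.SpecificFunctions
import Mathlib.Geometry.Manifold.ContMDiff.NormedSpace
import Mathlib.Analysis.Convex.Basic
import HarnessLib

/-!
# Crux `HawkingExtensionIsKerr` (stmt-FinalStateConjecture-17840), line `SketchIdeator2` —
# programme SEC, brick SEC-5d: a uniform finite family of K-charts

Helper file of the line lead (c7), registered sub-goal `stub_sec_unif`.

Programme SEC builds "K-charts" of the event horizon `𝓔⁺ = 𝓑.horizon` of a stationary black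
hole: mutually inverse `C^∞` maps `χ : W → O ⊆ E4`, `χi : O → W` straightening a vector field
`K` (`dχ K = e₀`), in which the horizon is `{χ · 1 = 0}` and the chart lines `σ ↦ χi (z + σ e₀)`
are integral curves of `K`.  This file is pure bookkeeping (compactness, shrinking boxes,
translating charts — no curvature, no geodesics):

* `stub_sec_unif` — if every point of `𝓔⁺` carries a K-chart inside `U`, then every compact
  `C ⊆ 𝓔⁺` is covered by FINITELY many K-charts `(W i, O i, χ i, χi i)` with CONVEX boxes and a
  UNIFORM room `δ > 0`: every `x ∈ C` lies in some `W i` with `|χ i x 0| < δ / 2`, and from any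
  point of `W i` with `|χ i x 0| < δ` the chart line through it stays in the box `O i` for all
  parameters `|s| < 2δ`.

Proof: all chart clauses are stable under SHRINKING the box to an open convex `O' ⊆ O`
(`secUnif_shrink`) and under TRANSLATING along `e₀` (`secUnif_translate`); shrink the chart at
`p` (with `χ p = 0`) to a cylinder `{|z₀| < r/2, ‖z - z₀ e₀‖ < r/2} ⊆ O`; a first finite subcover
of `C` by the sets `{|χ_p · 0| < r_p/16}` fixes `δ := min r_p / 8`; translating the chart of `x ∈ C`
so that `χ x 0 = 0` gives a chart with room `δ` (`secUnif_room`), and a second finite subcover by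
the sets `{|χ_x · 0| < δ/2}` is the family.  Everything used is Mathlib
(`IsCompact.elim_nhds_subcover`, `Finset.equivFin`); `e₀ = EuclideanSpace.single 0 1`.
-/

noncomputable section

set_option linter.dupNamespace false

namespace Summit.FinalStateConjecture.FinalStateConjecture.Theorems.HawkingExtensionIsKerr.SketchIdeator2

open Set Filter Bundle Function Literature.Geometry.Lorentzian
open scoped Manifold ContDiff Topology

/-! ### Stability of K-charts under shrinking and translating -/

/-- **Shrinking a K-chart.**  If `(W, O, χ, χi)` is a K-chart (mutually inverse `C^∞` maps,
`W ⊆ U`, `dχ K = e`, horizon `{χ · 1 = 0}`, chart lines `σ ↦ χi (z + σ e)` integral curves of `K`;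
in the application `e = e₀`, which is not used here) and `O' ⊆ O` is open and convex, then
`(W ∩ χ ⁻¹' O', O', χ, χi)` is a K-chart with a convex box. -/
private theorem secUnif_shrink (𝓑 : StationaryAFBlackHole.{0})
    (U : Set 𝓑.carrier) (K : Π x : 𝓑.carrier, TangentSpace (𝓡 4) x) {e : E4}
    {W : Set 𝓑.carrier} {O O' : Set E4} {χ : 𝓑.carrier → E4} {χi : E4 → 𝓑.carrier}
    (hW : IsOpen W) (hWU : W ⊆ U)
    (h1 : ∀ x ∈ W, χ x ∈ O ∧ χi (χ x) = x) (h2 : ∀ y ∈ O, χi y ∈ W ∧ χ (χi y) = y)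
    (hχ : ContMDiffOn (𝓡 4) 𝓘(ℝ, E4) ∞ χ W) (hχi : ContMDiffOn 𝓘(ℝ, E4) (𝓡 4) ∞ χi O)
    (hK : ∀ x ∈ W, mfderiv (𝓡 4) 𝓘(ℝ, E4) χ x (K x) = e)
    (hH : ∀ x ∈ W, x ∈ 𝓑.horizon ↔ χ x 1 = 0)
    (hI : ∀ x ∈ W, ∀ a b : ℝ, (∀ σ ∈ Ioo a b, χ x + σ • e ∈ O) →
      IsMIntegralCurveOn (fun σ : ℝ ↦ χi (χ x + σ • e)) K (Ioo a b))
    (hO'O : O' ⊆ O) (hO' : IsOpen O') (hO'c : Convex ℝ O') :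
    IsOpen (W ∩ χ ⁻¹' O') ∧ IsOpen O' ∧ Convex ℝ O' ∧ W ∩ χ ⁻¹' O' ⊆ U ∧
      (∀ x ∈ W ∩ χ ⁻¹' O', χ x ∈ O' ∧ χi (χ x) = x) ∧
      (∀ y ∈ O', χi y ∈ W ∩ χ ⁻¹' O' ∧ χ (χi y) = y) ∧
      ContMDiffOn (𝓡 4) 𝓘(ℝ, E4) ∞ χ (W ∩ χ ⁻¹' O') ∧ ContMDiffOn 𝓘(ℝ, E4) (𝓡 4) ∞ χi O' ∧
      (∀ x ∈ W ∩ χ ⁻¹' O', mfderiv (𝓡 4) 𝓘(ℝ, E4) χ x (K x) = e) ∧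
      (∀ x ∈ W ∩ χ ⁻¹' O', x ∈ 𝓑.horizon ↔ χ x 1 = 0) ∧
      (∀ x ∈ W ∩ χ ⁻¹' O', ∀ a b : ℝ, (∀ σ ∈ Ioo a b, χ x + σ • e ∈ O') →
        IsMIntegralCurveOn (fun σ : ℝ ↦ χi (χ x + σ • e)) K (Ioo a b)) := by
  refine ⟨hχ.continuousOn.isOpen_inter_preimage hW hO', hO', hO'c,
    inter_subset_left.trans hWU, fun x hx => ⟨hx.2, (h1 x hx.1).2⟩,
    fun y hy => ⟨⟨(h2 y (hO'O hy)).1, ?_⟩, (h2 y (hO'O hy)).2⟩,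
    hχ.mono inter_subset_left, hχi.mono hO'O, fun x hx => hK x hx.1, fun x hx => hH x hx.1,
    fun x hx a b hab => hI x hx.1 a b fun σ hσ => hO'O (hab σ hσ)⟩
  show χ (χi y) ∈ O'
  rw [(h2 y (hO'O hy)).2]; exact hy

/-- **Translating a K-chart.**  If `(W, O, χ, χi)` is a K-chart with a convex box (as in
`secUnif_shrink`), so is `(W, O - c, χ - c, χi (· + c))` for every vector `c` with `c 1 = 0` (in
the application `c = a e₀`): the straightening is unchanged since `d(χ - c) = dχ`, the horizon
clause since `c 1 = 0`, and the chart lines are the same curves. -/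
private theorem secUnif_translate (𝓑 : StationaryAFBlackHole.{0})
    (U : Set 𝓑.carrier) (K : Π x : 𝓑.carrier, TangentSpace (𝓡 4) x) {e : E4} (c : E4)
    (hc1 : c 1 = 0) {W : Set 𝓑.carrier} {O : Set E4} {χ : 𝓑.carrier → E4} {χi : E4 → 𝓑.carrier}
    (h : IsOpen W ∧ IsOpen O ∧ Convex ℝ O ∧ W ⊆ U ∧
      (∀ x ∈ W, χ x ∈ O ∧ χi (χ x) = x) ∧ (∀ y ∈ O, χi y ∈ W ∧ χ (χi y) = y) ∧
      ContMDiffOn (𝓡 4) 𝓘(ℝ, E4) ∞ χ W ∧ ContMDiffOn 𝓘(ℝ, E4) (𝓡 4) ∞ χi O ∧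
      (∀ x ∈ W, mfderiv (𝓡 4) 𝓘(ℝ, E4) χ x (K x) = e) ∧
      (∀ x ∈ W, x ∈ 𝓑.horizon ↔ χ x 1 = 0) ∧
      (∀ x ∈ W, ∀ a b : ℝ, (∀ σ ∈ Ioo a b, χ x + σ • e ∈ O) →
        IsMIntegralCurveOn (fun σ : ℝ ↦ χi (χ x + σ • e)) K (Ioo a b))) :
    IsOpen W ∧ IsOpen ((fun z : E4 => z + c) ⁻¹' O) ∧ Convex ℝ ((fun z : E4 => z + c) ⁻¹' O) ∧
      W ⊆ U ∧ (∀ x ∈ W, χ x - c ∈ (fun z : E4 => z + c) ⁻¹' O ∧ χi (χ x - c + c) = x) ∧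
      (∀ y ∈ (fun z : E4 => z + c) ⁻¹' O, χi (y + c) ∈ W ∧ χ (χi (y + c)) - c = y) ∧
      ContMDiffOn (𝓡 4) 𝓘(ℝ, E4) ∞ (fun x => χ x - c) W ∧
      ContMDiffOn 𝓘(ℝ, E4) (𝓡 4) ∞ (fun z => χi (z + c)) ((fun z : E4 => z + c) ⁻¹' O) ∧
      (∀ x ∈ W, mfderiv (𝓡 4) 𝓘(ℝ, E4) (fun x => χ x - c) x (K x) = e) ∧
      (∀ x ∈ W, x ∈ 𝓑.horizon ↔ (χ x - c) 1 = 0) ∧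
      (∀ x ∈ W, ∀ a b : ℝ, (∀ σ ∈ Ioo a b, χ x - c + σ • e ∈ (fun z : E4 => z + c) ⁻¹' O) →
        IsMIntegralCurveOn (fun σ : ℝ ↦ χi (χ x - c + σ • e + c)) K (Ioo a b)) := by
  obtain ⟨hW, hO, hOc, hWU, h1, h2, hχ, hχi, hK, hH, hI⟩ := h
  have hτ : ContMDiff 𝓘(ℝ, E4) 𝓘(ℝ, E4) ∞ (fun z : E4 => z + c) :=
    (contDiff_id.add contDiff_const).contMDiff
  have hτ' : ContMDiff 𝓘(ℝ, E4) 𝓘(ℝ, E4) ∞ (fun z : E4 => z - c) :=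
    (contDiff_id.sub contDiff_const).contMDiff
  refine ⟨hW, hO.preimage hτ.continuous, hOc.translate_preimage_left _, hWU, fun x hx => ?_,
    fun y hy => ?_, hτ'.comp_contMDiffOn hχ, hχi.comp hτ.contMDiffOn (fun _ hz => hz),
    fun x hx => ?_, fun x hx => ?_, fun x hx a b hab => ?_⟩
  · simpa only [mem_preimage, sub_add_cancel] using h1 x hx
  · refine ⟨(h2 (y + c) hy).1, ?_⟩
    rw [(h2 (y + c) hy).2, add_sub_cancel_right]
  · have hmd : MDifferentiableAt (𝓡 4) 𝓘(ℝ, E4) χ x :=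
      ((hχ x hx).contMDiffAt (hW.mem_nhds hx)).mdifferentiableAt (by simp)
    have hd := ((hmd.hasMFDerivAt.sub (hasMFDerivAt_const c x)).congr_mfderiv
      (sub_zero _)).mfderiv
    show mfderiv (𝓡 4) 𝓘(ℝ, E4) (χ - fun _ => c) x (K x) = e
    rw [hd]
    exact hK x hx
  · rw [hH x hx, PiLp.sub_apply, hc1, sub_zero]
  · have key : ∀ σ : ℝ, χ x - c + σ • e + c = χ x + σ • e := fun σ => by abel
    simp only [key]
    exact hI x hx a b fun σ hσ => by simpa only [mem_preimage, key] using hab σ hσ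

/-! ### Cylinders in `E4` and the room estimate -/

/-- The cylinder `{|z₀| < r/2, ‖z - z₀ e₀‖ < r/2}` of `E4` is open. -/
private theorem secUnif_cyl_isOpen (r : ℝ) :
    IsOpen {z : E4 | |z 0| < r / 2 ∧ ‖z - (z 0) • EuclideanSpace.single 0 1‖ < r / 2} :=
  (isOpen_lt (by fun_prop) continuous_const).and (isOpen_lt (by fun_prop) continuous_const)

/-- The cylinder `{|z₀| < r/2, ‖z - z₀ e₀‖ < r/2}` of `E4` is convex: a slab intersected with the
preimage of a ball under the linear map `z ↦ z - z₀ e₀`. -/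
private theorem secUnif_cyl_convex (r : ℝ) :
    Convex ℝ {z : E4 | |z 0| < r / 2 ∧ ‖z - (z 0) • EuclideanSpace.single 0 1‖ < r / 2} := by
  have hl₁ : IsLinearMap ℝ fun z : E4 => z 0 := ⟨fun _ _ => rfl, fun _ _ => rfl⟩
  have hl₂ : IsLinearMap ℝ fun z : E4 => z - (z 0) • (EuclideanSpace.single 0 1 : E4) :=
    ⟨fun x y => by simp only [PiLp.add_apply, add_smul]; abel,
     fun c x => by simp only [PiLp.smul_apply, smul_eq_mul]; module⟩
  have he : {z : E4 | |z 0| < r / 2 ∧ ‖z - (z 0) • EuclideanSpace.single 0 1‖ < r / 2} =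
      (fun z : E4 => z 0) ⁻¹' Metric.ball (0 : ℝ) (r / 2) ∩
        (fun z : E4 => z - (z 0) • (EuclideanSpace.single 0 1 : E4)) ⁻¹'
          Metric.ball (0 : E4) (r / 2) := by
    ext z
    simp
  rw [he]
  exact ((convex_ball (0 : ℝ) (r / 2)).is_linear_preimage hl₁).inter
    ((convex_ball (0 : E4) (r / 2)).is_linear_preimage hl₂)

/-- A point of the cylinder of radius `r` has norm `< r`: `‖z‖ ≤ |z₀| + ‖z - z₀ e₀‖`. -/
private theorem secUnif_cyl_subset {r : ℝ} {z : E4}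
    (hz : |z 0| < r / 2 ∧ ‖z - (z 0) • EuclideanSpace.single 0 1‖ < r / 2) :
    z ∈ Metric.ball (0 : E4) r := by
  rw [Metric.mem_ball, dist_zero_right]
  calc ‖z‖ = ‖(z 0) • EuclideanSpace.single 0 1 + (z - (z 0) • EuclideanSpace.single 0 1)‖ := by
        rw [add_sub_cancel]
    _ ≤ ‖(z 0) • (EuclideanSpace.single 0 1 : E4)‖ + ‖z - (z 0) • EuclideanSpace.single 0 1‖ :=
        norm_add_le _ _
    _ = |z 0| + ‖z - (z 0) • EuclideanSpace.single 0 1‖ := by simp [norm_smul]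
    _ < r := by linarith [hz.1, hz.2]

/-- **Room.**  For `z` in the cylinder of radius `r`, `|a| < r/16`, `δ ≤ r/8` and `|s| < 2δ`, the
point `(z' - z'₀ e₀) + s e₀ + a e₀`, `z' := z - a e₀`, lies in the cylinder again: its
`0`-coordinate is `s + a` and its transversal part is that of `z` (stated for `e = e₀`). -/
private theorem secUnif_room {e : E4} (he : e = EuclideanSpace.single 0 1) {r a δ s : ℝ}
    {z : E4} (ha : |a| < r / 16) (hδ : δ ≤ r / 8) (hs : |s| < 2 * δ)
    (hz : |z 0| < r / 2 ∧ ‖z - (z 0) • e‖ < r / 2) :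
    |(z - a • e - ((z - a • e) 0) • e + s • e + a • e) 0| < r / 2 ∧
      ‖z - a • e - ((z - a • e) 0) • e + s • e + a • e -
        ((z - a • e - ((z - a • e) 0) • e + s • e + a • e) 0) • e‖ < r / 2 := by
  have h0 : (z - a • e) 0 = z 0 - a := by simp [he]
  have h1 : (z - a • e - ((z - a • e) 0) • e + s • e + a • e) 0 = s + a := by simp [he]
  refine ⟨?_, ?_⟩
  · rw [h1]
    calc |s + a| ≤ |s| + |a| := abs_add_le s a
      _ < r / 2 := by linarith [abs_nonneg a]
  · rw [h1, h0]
    have : z - a • e - (z 0 - a) • e + s • e + a • e - (s + a) • e = z - (z 0) • e := by module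
    rw [this]
    exact hz.2

/-! ### Cylinder charts and their translates -/

/-- **Cylinder charts.**  A K-chart at `p ∈ 𝓔⁺` with `χ p = 0` (the hypothesis of
`stub_sec_unif` at `p`, stated for `e = e₀`) can be shrunk to a chart `W' ∋ p` whose box is a
cylinder `{|z₀| < r/2, ‖z - z₀ e₀‖ < r/2}`, `r > 0`; every translate of it by `|a| < r/16` along
`e₀` is a K-chart with a convex box, with coordinate `χ' · 0 = χ · 0 - a`, having room `δ` for
every `0 < δ ≤ r/8`. -/
private theorem secUnif_cylChart (𝓑 : StationaryAFBlackHole.{0})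
    (U : Set 𝓑.carrier) (K : Π x : 𝓑.carrier, TangentSpace (𝓡 4) x) (p : 𝓑.carrier) {e : E4}
    (he : e = EuclideanSpace.single 0 1)
    (hc : ∃ (W : Set 𝓑.carrier) (O : Set E4) (χ : 𝓑.carrier → E4) (χi : E4 → 𝓑.carrier),
      IsOpen W ∧ IsOpen O ∧ W ⊆ U ∧ p ∈ W ∧ χ p = 0 ∧ (∀ x ∈ W, χ x ∈ O ∧ χi (χ x) = x) ∧
      (∀ y ∈ O, χi y ∈ W ∧ χ (χi y) = y) ∧ ContMDiffOn (𝓡 4) 𝓘(ℝ, E4) ∞ χ W ∧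
      ContMDiffOn 𝓘(ℝ, E4) (𝓡 4) ∞ χi O ∧
      (∀ x ∈ W, mfderiv (𝓡 4) 𝓘(ℝ, E4) χ x (K x) = e) ∧
      (∀ x ∈ W, x ∈ 𝓑.horizon ↔ χ x 1 = 0) ∧
      (∀ x ∈ W, ∀ a b : ℝ, (∀ σ ∈ Ioo a b, χ x + σ • e ∈ O) →
        IsMIntegralCurveOn (fun σ : ℝ ↦ χi (χ x + σ • e)) K (Ioo a b)) ∧
      (∀ (γ : ℝ → 𝓑.carrier) (a b t₀ : ℝ), t₀ ∈ Ioo a b → IsMIntegralCurveOn γ K (Ioo a b) →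
        (∀ t ∈ Ioo a b, γ t ∈ W) → ∀ t ∈ Ioo a b, χ (γ t) = χ (γ t₀) + (t - t₀) • e)) :
    ∃ (W' : Set 𝓑.carrier) (χ : 𝓑.carrier → E4) (r : ℝ), p ∈ W' ∧ χ p = 0 ∧ 0 < r ∧
      IsOpen W' ∧ ContinuousOn χ W' ∧
      ∀ a δ : ℝ, |a| < r / 16 → 0 < δ → δ ≤ r / 8 →
        ∃ (O' : Set E4) (χ' : 𝓑.carrier → E4) (χi' : E4 → 𝓑.carrier),
          (∀ y, χ' y 0 = χ y 0 - a) ∧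
          (IsOpen W' ∧ IsOpen O' ∧ Convex ℝ O' ∧ W' ⊆ U ∧
            (∀ x ∈ W', χ' x ∈ O' ∧ χi' (χ' x) = x) ∧ (∀ y ∈ O', χi' y ∈ W' ∧ χ' (χi' y) = y) ∧
            ContMDiffOn (𝓡 4) 𝓘(ℝ, E4) ∞ χ' W' ∧ ContMDiffOn 𝓘(ℝ, E4) (𝓡 4) ∞ χi' O' ∧
            (∀ x ∈ W', mfderiv (𝓡 4) 𝓘(ℝ, E4) χ' x (K x) = e) ∧
            (∀ x ∈ W', x ∈ 𝓑.horizon ↔ χ' x 1 = 0) ∧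
            (∀ x ∈ W', ∀ a b : ℝ, (∀ σ ∈ Ioo a b, χ' x + σ • e ∈ O') →
              IsMIntegralCurveOn (fun σ : ℝ ↦ χi' (χ' x + σ • e)) K (Ioo a b))) ∧
          (∀ x ∈ W', |χ' x 0| < δ → ∀ s : ℝ, |s| < 2 * δ →
            (χ' x - (χ' x 0) • e) + s • e ∈ O') := by
  subst he
  obtain ⟨W, O, χ, χi, hW, hO, hWU, hp, hp0, h1, h2, hχ, hχi, hK, hH, hI, -⟩ := hc
  -- a ball inside the box, and the cylinder of that radius inside the ball
  have h0O : (0 : E4) ∈ O := hp0 ▸ (h1 p hp).1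
  obtain ⟨r, hr, hrO⟩ := Metric.isOpen_iff.mp hO 0 h0O
  have hS := secUnif_shrink 𝓑 U K hW hWU h1 h2 hχ hχi hK hH hI
    (fun z hz => hrO (secUnif_cyl_subset hz)) (secUnif_cyl_isOpen r) (secUnif_cyl_convex r)
  refine ⟨W ∩ χ ⁻¹' {z : E4 | |z 0| < r / 2 ∧ ‖z - (z 0) • EuclideanSpace.single 0 1‖ < r / 2},
    χ, r, ⟨hp, ?_⟩, hp0, hr, hS.1, (hχ.mono inter_subset_left).continuousOn,
    fun a δ ha _ hδr => ?_⟩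
  · show χ p ∈ {z : E4 | |z 0| < r / 2 ∧ ‖z - (z 0) • EuclideanSpace.single 0 1‖ < r / 2}
    rw [mem_setOf_eq, hp0]
    have hr2 : 0 < r / 2 := half_pos hr
    constructor <;> simpa using hr2
  · refine ⟨(fun z : E4 => z + a • EuclideanSpace.single 0 1) ⁻¹'
        {z : E4 | |z 0| < r / 2 ∧ ‖z - (z 0) • EuclideanSpace.single 0 1‖ < r / 2},
      fun y => χ y - a • EuclideanSpace.single 0 1,
      fun z => χi (z + a • EuclideanSpace.single 0 1), fun y => by simp,
      secUnif_translate 𝓑 U K (a • EuclideanSpace.single 0 1) (by simp) hS,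
      fun x hx _ s hs => ?_⟩
    have hz : |χ x 0| < r / 2 ∧ ‖χ x - (χ x 0) • EuclideanSpace.single 0 1‖ < r / 2 := hx.2
    simp only [mem_preimage, mem_setOf_eq]
    exact secUnif_room rfl ha hδr hs hz

/-! ### The registered sub-goal -/

/-- **SEC-5d (uniform finite family of K-charts).**  Let `C ⊆ 𝓔⁺` be compact and suppose every
`p ∈ 𝓔⁺` carries a K-chart `(W, O, χ, χi)` inside `U` centred at `p` (`χ p = 0`): mutually
inverse `C^∞` maps straightening `K` (`dχ K = e₀`), with `𝓔⁺ ∩ W = {χ · 1 = 0}`, whose chart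
lines are integral curves of `K` and in which integral curves of `K` read as translations along
`e₀`.  Then there are finitely many K-charts `(W i, O i, χ i, χi i)`, `i < N`, with CONVEX boxes,
and a uniform `δ > 0`, such that (ROOM) from every `x ∈ W i` with `|χ i x 0| < δ` the straight
line `(χ i x - (χ i x 0) e₀) + s e₀` stays in `O i` for `|s| < 2δ`, and (COVER) every `x ∈ C` lies
in some `W i` with `|χ i x 0| < δ / 2`.  Two finite subcovers of `C`: by cylinder charts (fixing
`δ`), then by their translates centred at the points of `C`. -/
theorem stub_sec_unif : ∀ (𝓑 : StationaryAFBlackHole.{0}) [𝓑.metric.HasLeviCivita]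
    (U : Set 𝓑.carrier) (K : Π x : 𝓑.carrier, TangentSpace (𝓡 4) x) (C : Set 𝓑.carrier),
    C ⊆ 𝓑.horizon → IsCompact C → (∀ p ∈ 𝓑.horizon, ∃ (W : Set 𝓑.carrier) (O : Set E4)
    (χ : 𝓑.carrier → E4) (χi : E4 → 𝓑.carrier), IsOpen W ∧ IsOpen O ∧ W ⊆ U ∧ p ∈ W ∧ χ p = 0 ∧
    (∀ x ∈ W, χ x ∈ O ∧ χi (χ x) = x) ∧ (∀ y ∈ O, χi y ∈ W ∧ χ (χi y) = y) ∧
    ContMDiffOn (𝓡 4) 𝓘(ℝ, E4) ∞ χ W ∧ ContMDiffOn 𝓘(ℝ, E4) (𝓡 4) ∞ χi O ∧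
    (∀ x ∈ W, mfderiv (𝓡 4) 𝓘(ℝ, E4) χ x (K x) = EuclideanSpace.single 0 1) ∧
    (∀ x ∈ W, x ∈ 𝓑.horizon ↔ χ x 1 = 0) ∧
    (∀ x ∈ W, ∀ a b : ℝ, (∀ σ ∈ Ioo a b, χ x + σ • EuclideanSpace.single 0 1 ∈ O) →
    IsMIntegralCurveOn (fun σ : ℝ ↦ χi (χ x + σ • EuclideanSpace.single 0 1)) K (Ioo a b)) ∧
    (∀ (γ : ℝ → 𝓑.carrier) (a b t₀ : ℝ), t₀ ∈ Ioo a b → IsMIntegralCurveOn γ K (Ioo a b) →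
    (∀ t ∈ Ioo a b, γ t ∈ W) → ∀ t ∈ Ioo a b,
    χ (γ t) = χ (γ t₀) + (t - t₀) • EuclideanSpace.single 0 1)) →
    ∃ (N : ℕ) (δ : ℝ) (W : Fin N → Set 𝓑.carrier) (O : Fin N → Set E4)
    (χ : Fin N → 𝓑.carrier → E4) (χi : Fin N → E4 → 𝓑.carrier), 0 < δ ∧
    (∀ i, IsOpen (W i) ∧ IsOpen (O i) ∧ Convex ℝ (O i) ∧ W i ⊆ U ∧
    (∀ x ∈ W i, χ i x ∈ O i ∧ χi i (χ i x) = x) ∧ (∀ y ∈ O i, χi i y ∈ W i ∧ χ i (χi i y) = y) ∧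
    ContMDiffOn (𝓡 4) 𝓘(ℝ, E4) ∞ (χ i) (W i) ∧ ContMDiffOn 𝓘(ℝ, E4) (𝓡 4) ∞ (χi i) (O i) ∧
    (∀ x ∈ W i, mfderiv (𝓡 4) 𝓘(ℝ, E4) (χ i) x (K x) = EuclideanSpace.single 0 1) ∧
    (∀ x ∈ W i, x ∈ 𝓑.horizon ↔ χ i x 1 = 0) ∧
    (∀ x ∈ W i, ∀ a b : ℝ, (∀ σ ∈ Ioo a b, χ i x + σ • EuclideanSpace.single 0 1 ∈ O i) →
    IsMIntegralCurveOn (fun σ : ℝ ↦ χi i (χ i x + σ • EuclideanSpace.single 0 1)) K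
    (Ioo a b))) ∧
    (∀ i, ∀ x ∈ W i, |χ i x 0| < δ → ∀ s : ℝ, |s| < 2 * δ →
    (χ i x - (χ i x 0) • EuclideanSpace.single 0 1) + s • EuclideanSpace.single 0 1 ∈ O i) ∧
    (∀ x ∈ C, ∃ i, x ∈ W i ∧ |χ i x 0| < δ / 2) := by
  intro 𝓑 _ U K C hC hCc hcharts
  -- Stage 1: cylinder charts at the points of `𝓔⁺`, a first finite subcover of `C`, and `δ`.
  choose! W₁ χ₁ r₁ hpW h0 hr hWo hco hT using
    fun p (hp : p ∈ 𝓑.horizon) => secUnif_cylChart 𝓑 U K p rfl (hcharts p hp)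
  have hS : ∀ p ∈ C, W₁ p ∩ χ₁ p ⁻¹' {z : E4 | |z 0| < r₁ p / 16} ∈ 𝓝 p := fun p hp =>
    ((hco p (hC hp)).isOpen_inter_preimage (hWo p (hC hp))
      (isOpen_lt (by fun_prop) continuous_const)).mem_nhds
      ⟨hpW p (hC hp), by
        simpa [h0 p (hC hp)] using (show (0 : ℝ) < r₁ p / 16 by linarith [hr p (hC hp)])⟩
  obtain ⟨t, htC, hCt⟩ := hCc.elim_nhds_subcover _ hS
  rcases t.eq_empty_or_nonempty with rfl | hne
  · refine ⟨0, 1, fun i => i.elim0, fun i => i.elim0, fun i => i.elim0, fun i => i.elim0,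
      one_pos, fun i => i.elim0, fun i => i.elim0, fun x hx => ?_⟩
    simpa using hCt hx
  obtain ⟨δ, hδ, hδr⟩ : ∃ δ : ℝ, 0 < δ ∧ ∀ p ∈ t, δ ≤ r₁ p / 8 := by
    obtain ⟨p₀, hp₀t, hp₀⟩ := t.exists_min_image r₁ hne
    exact ⟨r₁ p₀ / 8, by linarith [hr p₀ (hC (htC p₀ hp₀t))],
      fun p hp => by linarith [hp₀ p hp]⟩
  -- Stage 2: translated charts centred at the points of `C`, with room `δ`.
  have hB : ∀ x ∈ C, ∃ (W : Set 𝓑.carrier) (O : Set E4) (χ : 𝓑.carrier → E4)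
      (χi : E4 → 𝓑.carrier), (x ∈ W ∧ χ x 0 = 0) ∧
      (IsOpen W ∧ IsOpen O ∧ Convex ℝ O ∧ W ⊆ U ∧
        (∀ x ∈ W, χ x ∈ O ∧ χi (χ x) = x) ∧ (∀ y ∈ O, χi y ∈ W ∧ χ (χi y) = y) ∧
        ContMDiffOn (𝓡 4) 𝓘(ℝ, E4) ∞ χ W ∧ ContMDiffOn 𝓘(ℝ, E4) (𝓡 4) ∞ χi O ∧
        (∀ x ∈ W, mfderiv (𝓡 4) 𝓘(ℝ, E4) χ x (K x) = EuclideanSpace.single 0 1) ∧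
        (∀ x ∈ W, x ∈ 𝓑.horizon ↔ χ x 1 = 0) ∧
        (∀ x ∈ W, ∀ a b : ℝ, (∀ σ ∈ Ioo a b, χ x + σ • EuclideanSpace.single 0 1 ∈ O) →
          IsMIntegralCurveOn (fun σ : ℝ ↦ χi (χ x + σ • EuclideanSpace.single 0 1)) K
            (Ioo a b))) ∧
      (∀ x ∈ W, |χ x 0| < δ → ∀ s : ℝ, |s| < 2 * δ →
        (χ x - (χ x 0) • EuclideanSpace.single 0 1) + s • EuclideanSpace.single 0 1 ∈ O) := by
    intro x hx
    obtain ⟨p, hpt, hxp⟩ := mem_iUnion₂.mp (hCt hx)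
    have hp : p ∈ 𝓑.horizon := hC (htC p hpt)
    have ha : |χ₁ p x 0| < r₁ p / 16 := hxp.2
    obtain ⟨O', χ', χi', hc, hgood, hroom⟩ := hT p hp (χ₁ p x 0) δ ha hδ (hδr p hpt)
    exact ⟨W₁ p, O', χ', χi', ⟨hxp.1, by rw [hc, sub_self]⟩, hgood, hroom⟩
  choose! W₂ O₂ χ₂ χi₂ hxW hgood hroom using hB
  have hR : ∀ x ∈ C, W₂ x ∩ χ₂ x ⁻¹' {z : E4 | |z 0| < δ / 2} ∈ 𝓝 x := fun x hx =>
    ((hgood x hx).2.2.2.2.2.2.1.continuousOn.isOpen_inter_preimage (hgood x hx).1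
      (isOpen_lt (by fun_prop) continuous_const)).mem_nhds
      ⟨(hxW x hx).1, by simpa [(hxW x hx).2] using half_pos hδ⟩
  obtain ⟨t₂, ht₂C, hCt₂⟩ := hCc.elim_nhds_subcover _ hR
  refine ⟨t₂.card, δ, fun i => W₂ (t₂.equivFin.symm i), fun i => O₂ (t₂.equivFin.symm i),
    fun i => χ₂ (t₂.equivFin.symm i), fun i => χi₂ (t₂.equivFin.symm i), hδ,
    fun i => hgood _ (ht₂C _ (t₂.equivFin.symm i).2),
    fun i => hroom _ (ht₂C _ (t₂.equivFin.symm i).2), fun x hx => ?_⟩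
  obtain ⟨y, hyt, hxy⟩ := mem_iUnion₂.mp (hCt₂ hx)
  refine ⟨t₂.equivFin ⟨y, hyt⟩, ?_⟩
  simp only [Equiv.symm_apply_apply]
  exact ⟨hxy.1, hxy.2⟩

end Summit.FinalStateConjecture.FinalStateConjecture.Theorems.HawkingExtensionIsKerr.SketchIdeator2

end
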